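import Summits.ResolutionOfSingularities.ResolutionOfSingularities.Theses.FrobeniusLadder
import Summits.ResolutionOfSingularities.ResolutionOfSingularities.Theorems.FrobeniusLadderFInjectiveMacaulayficationTrFull
import Summits.ResolutionOfSingularities.ResolutionOfSingularities.Theorems.FrobeniusLadderFInjectiveMacaulayficationOfTrRungs
import HarnessLib


/-!
# Crux `FInjectiveMacaulayfication` (stmt-ResolutionOfSingularities-15315) — v40 «LOCAL-FULL DOOR»: AUDIT TWINS (companion of the registered skeleton `Lines/local_full.lean`)

[OURS · L1 W4.5a] Sorry-free plumbing moved VERBATIM out of res-L1-w45a-stub-3 g9ʼs draft `afa2437927180307` by the registrar res-L1-w45a-lead-1 g8 (see the REGISTRAR NOTE in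
`Lines/local_full.lean`): they show the v40 residue is KERNEL-WEAKER-OR-EQUAL to v38ʼs (R18.7 criterion) — v38ʼs residue implies the crux through v40ʼs assembly, and v40ʼs
residue gives v38ʼs T-rungs back given the prints and the F-half. AI-written (AI review is weaker than expert review).
-/

-- single-problem summit: the doubled namespace component is forced
set_option linter.dupNamespace false

noncomputable section

namespace Summit.ResolutionOfSingularities.ResolutionOfSingularities.Cruxes.FInjectiveMacaulayfication.LocalFullTwins

open AlgebraicGeometry CategoryTheory Literature.AlgebraicGeometry.Resolution

/-- AUDIT TWIN 1 (sorry-free given the stubs' statements as hypotheses): v38's residue IMPLIES v40's — T ⇒ T_FULL by restriction (`TrFull.trFull_of_tr`) — so the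
v40 letter is the kernel-weakest of the three lines (R18.7 criterion); then v40's assembly. [OURS · plumbing; v40] -/
theorem FInjectiveMacaulayfication_of_v38_residue
    (hF : Literature.AlgebraicGeometry.Resolution.CossartPiltant2019General.{0} ∧ Literature.AlgebraicGeometry.Resolution.Stacks081R.{0} ∧
      Literature.AlgebraicGeometry.Resolution.CossartPiltant2019Principalization.{0} ∧ Literature.AlgebraicGeometry.Resolution.CesnaviciusBlowupMacaulayficationOffClosed.{0})
    (hT1 : ∀ p e : ℕ, p.Prime → 4 ≤ e →
      Summit.ResolutionOfSingularities.ResolutionOfSingularities.Theorems.FInjectiveMacaulayfication.ClosedPointLocalResolutionAdmTr.ClosedPointLocalResolutionAdmTr p e 1)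
    (hFadm : Summit.ResolutionOfSingularities.ResolutionOfSingularities.Theorems.FInjectiveMacaulayfication.LocalFullificationFibreAdmGe4Split.LocalFInjectivizationFibreAdmGe4) :
    Summit.ResolutionOfSingularities.ResolutionOfSingularities.Theses.FrobeniusLadder.FInjectiveMacaulayfication :=
  Summit.ResolutionOfSingularities.ResolutionOfSingularities.Theorems.FInjectiveMacaulayfication.TrFull.fInjectiveMacaulayfication_of_prints_of_LFadmF_of_trFullOne
    hF.1 hF.2.1 hF.2.2.1 hF.2.2.2 hFadm
    fun p e hp he => Summit.ResolutionOfSingularities.ResolutionOfSingularities.Theorems.FInjectiveMacaulayfication.TrFull.trFull_of_tr (hT1 p e hp he)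

/-- AUDIT TWIN 2 (sorry-free given the stubs' statements as hypotheses): v40's residue gives back v38's T-rungs at every level given the prints and the F-half
(`TrFull.tr_le_of_prints_of_F_of_trFull` ∘ `forall_trFull_of_one`), then v38's assembly `OfTrRungs…` — the square closes. [OURS · plumbing; v40] -/
theorem FInjectiveMacaulayfication_via_v38
    (hF : Literature.AlgebraicGeometry.Resolution.CossartPiltant2019General.{0} ∧ Literature.AlgebraicGeometry.Resolution.Stacks081R.{0} ∧
      Literature.AlgebraicGeometry.Resolution.CossartPiltant2019Principalization.{0} ∧ Literature.AlgebraicGeometry.Resolution.CesnaviciusBlowupMacaulayficationOffClosed.{0})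
    (hTF1 : ∀ p e : ℕ, p.Prime → 4 ≤ e →
      Summit.ResolutionOfSingularities.ResolutionOfSingularities.Theorems.FInjectiveMacaulayfication.TrFull.ClosedPointLocalResolutionFullTr p e 1)
    (hFadm : Summit.ResolutionOfSingularities.ResolutionOfSingularities.Theorems.FInjectiveMacaulayfication.LocalFullificationFibreAdmGe4Split.LocalFInjectivizationFibreAdmGe4) :
    Summit.ResolutionOfSingularities.ResolutionOfSingularities.Theses.FrobeniusLadder.FInjectiveMacaulayfication :=
  Summit.ResolutionOfSingularities.ResolutionOfSingularities.Theorems.FInjectiveMacaulayfication.OfTrRungs.fInjectiveMacaulayfication_of_trRungs_of_cesnaviciusOffClosed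
    hF.1 hF.2.1 hF.2.2.1 hF.2.2.2
    (fun p e r hp he hr =>
      Summit.ResolutionOfSingularities.ResolutionOfSingularities.Theorems.FInjectiveMacaulayfication.TrFull.tr_le_of_prints_of_F_of_trFull e
        hF.1 hF.2.1 hF.2.2.1 hF.2.2.2 hp (fun e' h4 _ => hFadm e' h4 p hp)
        (fun e' r' h4' _ hr' => Summit.ResolutionOfSingularities.ResolutionOfSingularities.Theorems.FInjectiveMacaulayfication.TrFull.forall_trFull_of_one
          (hTF1 p e' hp h4') r' hr')
        e r he le_rfl hr)
    hFadm

end Summit.ResolutionOfSingularities.ResolutionOfSingularities.Cruxes.FInjectiveMacaulayfication.LocalFullTwins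

end
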